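import Literature.Analysis.FluidPDE.NSFourierFamily
import Literature.Analysis.FunctionSpaces.TorusFourierSeries
import HarnessLib

/-!
# Fourier-side objects for the forced advection–diffusion equation on `T^d`: definitions

Analysis/FluidPDE definition file, first of the files discharging the named fact
`Literature.Analysis.FluidPDE.Torus.exists_unique_isClassicalScalarTransportForcedOn`
(`PassiveScalarWellPosedness`: classical well-posedness of `∂ₜθ + u·∇θ = κΔθ + s` on
`[0, T] × T^d` for smooth drift, source and datum; Krylov 1996, Thm. 9.2.3 for the printed
Hölder-space statement). The discharge does **not** follow Krylov's Schauder/continuity method;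
for smooth periodic data the solution is constructed on the Fourier side, exactly as the tree's
construction of Leray's local regular solution on `ℝ³` (`NSFourierWeights` … `NSFourierSolution`,
sub-namespace `FourierNS`), with the Fourier integral replaced by the Fourier series of
`T^d = UnitAddTorus d` (frequencies `k ∈ ℤ^d = d → ℤ`, characters `UnitAddTorus.mFourier k`):

* the unknown is the coefficient field `c(t, k) = 𝓕(θ(t))(k)`; the equation becomes the mild
  (Duhamel) system `c(t,k) = e^{-νₖt} θ̂₀(k) + ∫₀ᵗ e^{-νₖ(t-s)} (ŝ(s,k) - N(û(s), c(s))(k)) ds`,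
  `νₖ = 4π²κ|k|²` (`heatRate`), with the **transport symbol**
  `N(U, c)(k) = ∑ⱼ ∑ₘ Uⱼ(m) · 2πi (k-m)ⱼ c(k-m)` (`transportSym`; the coefficients of `u·∇θ`,
  products ↦ lattice convolutions `lconv`, `∂ⱼ ↦ 2πi kⱼ` = `dsym`, Grafakos 2014,
  Prop. 3.2.6 (8));
* it is solved by Picard iteration of the clamped Duhamel map (`picardMap`, `picardIter`,
  `picardLim`; clamped time `FourierNS.clamp` as in `NSFourierPicard`), a contraction in weighted
  sup-norms `sup e^{-λt} (1+‖k‖)^K |c(t,k)|` (file `ScalarFourierPicard`);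
* all time derivatives of `c` are organised in **coefficient families** `IsCoeffFamily T n W`
  (`W₀, …, W_n` with `∂ₜWᵢ = Wᵢ₊₁` within `[0,T]`, every polynomial decay uniformly in time;
  the series twin of `FourierNS.IsFourierFamily`), built by the bootstrap `consFamily` /
  `bootRHS` (file `ScalarFourierTimeRegularity`) from the families `coeffFamily` of the data;
* the solution is synthesized as `θ(t, x) = Re ∑ₖ c(t,k) e_k(x)` (`torusSynth`, `synth`,
  `dmulFamily`; file `ScalarFourierSynthesis`).

This file only introduces the objects (with unfolding lemmas); all estimates are in the sequel
files. Decay is measured by `FourierNS.HasDecay K C f : ‖f m‖ ≤ C (1 + ‖m‖)^{-K}` with the sup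
norm `‖m‖ = maxᵢ |mᵢ|` of `m : d → ℤ`; the summable order is `latOrder d = 2 · #d`
(`∑ₘ (1+‖m‖)^{-2#d} < ∞`, file `ScalarFourierFamily`).

## References

* N. V. Krylov, *Lectures on Elliptic and Parabolic Equations in Hölder Spaces*, GSM 12, AMS
  1996, Thm. 9.2.3 (PDF p. 151), Thm. 8.12.1, Ex. 8.12.4. [Krylov1996]
* L. Grafakos, *Classical Fourier Analysis*, 3rd ed., GTM 249 (2014), Prop. 3.2.6 (8),
  §3.3.1 (Fourier series of smooth functions on `Tⁿ`). [Grafakos2014]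
* L. C. Evans, *Partial Differential Equations*, 2nd ed. (2010), §7.1.2–7.1.3 (Galerkin /
  Fourier construction and regularity for linear parabolic equations).
* P. G. Lemarié-Rieusset, *The Navier–Stokes problem in the 21st century*, CRC 2016, §8.5
  (mild formulation in weighted sup-norms on the Fourier side).
-/

noncomputable section

open MeasureTheory Real Set Filter UnitAddTorus
open scoped Topology RealInnerProductSpace

namespace Literature.Analysis.FluidPDE

namespace ScalarFourier

variable {d : Type*} [Fintype d]

/-! ### Lattice convolution and the transport symbol -/

section Lattice

/-- The **summable order** on the lattice `ℤ^d`: `latOrder d = 2 · #d`, for which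
`∑ₘ (1 + ‖m‖)^{-latOrder d} < ∞` (sup norm on `d → ℤ`). [folklore] -/
def latOrder (d : Type*) [Fintype d] : ℕ := 2 * Fintype.card d

/-- The **lattice weight mass** `∑ₘ (1 + ‖m‖)^{-2#d}` (a real number; the series converges,
`ScalarFourierFamily`). [folklore] -/
def latMass (d : Type*) [Fintype d] : ℝ := ∑' m : d → ℤ, ((1 + ‖m‖) ^ latOrder d)⁻¹

/-- **Lattice convolution** of two coefficient sequences on `ℤ^d`:
`(f ⋆ g)(k) = ∑ₘ f(m) g(k - m)` (the Fourier coefficients of a product, Grafakos 2014, §3.1;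
junk value `0` of `tsum` when the family is not summable). [folklore] -/
def lconv (f g : (d → ℤ) → ℂ) (k : d → ℤ) : ℂ := ∑' m, f m * g (k - m)

omit [Fintype d] in
/-- Unfolding `lconv`. [folklore] -/
theorem lconv_apply (f g : (d → ℤ) → ℂ) (k : d → ℤ) : lconv f g k = ∑' m, f m * g (k - m) := rfl

/-- The **derivative symbol** `∂ⱼ ↔ 2πi kⱼ` on `T^d = ℝ^d/ℤ^d`
(`𝓕(∂ⱼ g)(k) = 2πi kⱼ 𝓕g(k)`, Grafakos 2014, Prop. 3.2.6 (8); tree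
`Torus.mFourierCoeff_partialDeriv`). [folklore] -/
def dsym (j : d) (k : d → ℤ) : ℂ := 2 * π * Complex.I * (k j : ℂ)

omit [Fintype d] in
/-- Unfolding `dsym`. [folklore] -/
theorem dsym_apply (j : d) (k : d → ℤ) : dsym j k = 2 * π * Complex.I * (k j : ℂ) := rfl

/-- The **transport symbol**: the Fourier coefficients of `u·∇θ = ∑ⱼ uⱼ ∂ⱼθ` in terms of the
coefficients `Uⱼ = ûⱼ` of the drift components and `c = θ̂` of the scalar,
`N(U, c)(k) = ∑ⱼ (Uⱼ ⋆ (2πi (·)ⱼ c))(k) = ∑ⱼ ∑ₘ Uⱼ(m) 2πi (k - m)ⱼ c(k - m)`. [folklore] -/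
def transportSym (U : d → (d → ℤ) → ℂ) (c : (d → ℤ) → ℂ) (k : d → ℤ) : ℂ :=
  ∑ j, lconv (U j) (fun m => dsym j m * c m) k

/-- Unfolding `transportSym`. [folklore] -/
theorem transportSym_apply (U : d → (d → ℤ) → ℂ) (c : (d → ℤ) → ℂ) (k : d → ℤ) :
    transportSym U c k = ∑ j, lconv (U j) (fun m => dsym j m * c m) k := rfl

end Lattice

/-! ### Coefficient families on `[0, T]` -/

section Family

/-- **Coefficient family of order `n` on `[0, T]`**: `W₀, …, W_n : ℝ → ℤ^d → ℂ` have every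
polynomial decay uniformly in `t ∈ [0, T]`, are continuous in `t ∈ [0, T]` at each frequency,
and `∂ₜ Wᵢ = Wᵢ₊₁` within `[0, T]` (`i < n`) at each frequency — the Fourier-series content of
"`∂ₜⁱ θ` exists and is smooth in `x` up to the time boundary" for `θ(t) = ∑ₖ W₀(t,k) e_k`
(series twin of `FourierNS.IsFourierFamily`; no measurability clause is needed on the countable
lattice). [folklore] -/
structure IsCoeffFamily (T : ℝ) (n : ℕ) (W : ℕ → ℝ → (d → ℤ) → ℂ) : Prop where
  /-- every polynomial decay, uniformly on `[0, T]` -/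
  decay : ∀ i ≤ n, ∀ K : ℕ, ∃ C : ℝ, ∀ t ∈ Icc 0 T, FourierNS.HasDecay K C (W i t)
  /-- continuity in time on `[0, T]` at each frequency -/
  cont : ∀ i ≤ n, ∀ m, ContinuousOn (fun t => W i t m) (Icc 0 T)
  /-- `∂ₜ Wᵢ = Wᵢ₊₁` within `[0, T]` at each frequency -/
  deriv : ∀ i < n, ∀ m, ∀ t ∈ Icc 0 T,
    HasDerivWithinAt (fun s => W i s m) (W (i + 1) t m) (Icc 0 T) t

/-- Prepending a zeroth member `c` to a sequence `D` of coefficient fields: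
`consFamily c D = (c, D₀, D₁, …)` (the bootstrap step `Wᵢ₊₁ := ∂ₜWᵢ`, as
`FourierNS.consFamily`). [folklore] -/
def consFamily (c : ℝ → (d → ℤ) → ℂ) (D : ℕ → ℝ → (d → ℤ) → ℂ) : ℕ → ℝ → (d → ℤ) → ℂ
  | 0 => c
  | i + 1 => D i

omit [Fintype d] in
/-- The zeroth member of `consFamily c D` is `c`. [folklore] -/
@[simp] theorem consFamily_zero (c : ℝ → (d → ℤ) → ℂ) (D : ℕ → ℝ → (d → ℤ) → ℂ) :
    consFamily c D 0 = c := rfl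

omit [Fintype d] in
/-- The later members of `consFamily c D` are the `D i`. [folklore] -/
@[simp] theorem consFamily_succ (c : ℝ → (d → ℤ) → ℂ) (D : ℕ → ℝ → (d → ℤ) → ℂ) (i : ℕ) :
    consFamily c D (i + 1) = D i := rfl

/-- The **Leibniz family** of the lattice convolution of two families:
`Lᵢ(t) = ∑_{l ≤ i} C(i, l) F_l(t) ⋆ G_{i-l}(t)`, the candidate for `∂ₜⁱ (F₀ ⋆ G₀)`. [folklore] -/
def leibnizFamily (F G : ℕ → ℝ → (d → ℤ) → ℂ) : ℕ → ℝ → (d → ℤ) → ℂ :=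
  fun i t k => ∑ l ∈ Finset.range (i + 1), (i.choose l : ℂ) * lconv (F l t) (G (i - l) t) k

omit [Fintype d] in
/-- `L₀ = F₀ ⋆ G₀`. [folklore] -/
@[simp]
theorem leibnizFamily_zero (F G : ℕ → ℝ → (d → ℤ) → ℂ) (t : ℝ) (k : d → ℤ) :
    leibnizFamily F G 0 t k = lconv (F 0 t) (G 0 t) k := by
  simp [leibnizFamily]

/-- The **transport family**: the Leibniz families of the transport symbol,
`Nᵢ(t)(k) = ∑ⱼ ∑_{l ≤ i} C(i,l) (U^{(l)}ⱼ(t) ⋆ (2πi (·)ⱼ W_{i-l}(t)))(k)`, the candidate for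
`∂ₜⁱ N(U(t), W₀(t))` when `U^{(l)}ⱼ = ∂ₜˡ ûⱼ`. [folklore] -/
def transportFamily (UF : d → ℕ → ℝ → (d → ℤ) → ℂ) (W : ℕ → ℝ → (d → ℤ) → ℂ) :
    ℕ → ℝ → (d → ℤ) → ℂ :=
  fun i t k => ∑ j, leibnizFamily (UF j) (fun i' t' m => dsym j m * W i' t' m) i t k

/-- `N₀(t) = N(U₀(t), W₀(t))`. [folklore] -/
@[simp]
theorem transportFamily_zero (UF : d → ℕ → ℝ → (d → ℤ) → ℂ) (W : ℕ → ℝ → (d → ℤ) → ℂ)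
    (t : ℝ) (k : d → ℤ) :
    transportFamily UF W 0 t k = transportSym (fun j => UF j 0 t) (W 0 t) k := by
  simp [transportFamily, transportSym]

/-- The **coefficient family of a space–time field** `ψ : ℝ → T^d → ℂ` on the time set `S`:
`(coeffFamily S ψ) i t k = 𝓕((∂ₜⁱψ)(t))(k)`, with the one-sided time derivative
`Torus.timeDerivWithin S` iterated `i` times (for jointly smooth `ψ` on `[0,T] × T^d` this is a
coefficient family of every order, file `ScalarFourierData`). [folklore] -/
def coeffFamily (S : Set ℝ) (ψ : ℝ → UnitAddTorus d → ℂ) : ℕ → ℝ → (d → ℤ) → ℂ :=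
  fun i t k => mFourierCoeff ((FunctionSpaces.Torus.timeDerivWithin S)^[i] ψ t) k

/-- Unfolding `coeffFamily` at order `0`: the coefficients of the slices. [folklore] -/
@[simp]
theorem coeffFamily_zero (S : Set ℝ) (ψ : ℝ → UnitAddTorus d → ℂ) (t : ℝ) (k : d → ℤ) :
    coeffFamily S ψ 0 t k = mFourierCoeff (ψ t) k := rfl

/-- Unfolding `coeffFamily` at order `i + 1`: the family of `∂ₜψ`, shifted. [folklore] -/
theorem coeffFamily_succ (S : Set ℝ) (ψ : ℝ → UnitAddTorus d → ℂ) (i : ℕ) :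
    coeffFamily S ψ (i + 1) = coeffFamily S (FunctionSpaces.Torus.timeDerivWithin S ψ) i := by
  funext t k
  simp [coeffFamily, Function.iterate_succ_apply]

end Family

/-! ### Synthesis -/

section Synthesis

/-- The **Fourier series with time-dependent coefficients** `c`:
`torusSynth c t x = ∑ₖ c(t, k) e_k(x)` on `T^d` (junk value `0` of `tsum` if not summable;
Grafakos 2014, §3.3.1, Fourier inversion for absolutely summable coefficients). [folklore] -/
def torusSynth (c : ℝ → (d → ℤ) → ℂ) (t : ℝ) (x : UnitAddTorus d) : ℂ :=
  ∑' k, c t k * mFourier k x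

/-- Unfolding `torusSynth`. [folklore] -/
theorem torusSynth_apply (c : ℝ → (d → ℤ) → ℂ) (t : ℝ) (x : UnitAddTorus d) :
    torusSynth c t x = ∑' k, c t k * mFourier k x := rfl

/-- The **synthesized field of a family** on `ℝ × ℝ^d`: the space–time lift of the series of
its zeroth member, `synth W (t, y) = ∑ₖ W₀(t, k) e_k(proj y)` (series twin of
`FourierNS.synth`). [folklore] -/
def synth (W : ℕ → ℝ → (d → ℤ) → ℂ) : ℝ × EuclideanSpace ℝ d → ℂ :=
  FunctionSpaces.Torus.stLift (torusSynth (W 0))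

/-- Unfolding `synth`. [folklore] -/
theorem synth_apply (W : ℕ → ℝ → (d → ℤ) → ℂ) (z : ℝ × EuclideanSpace ℝ d) :
    synth W z = ∑' k, W 0 z.1 k * mFourier k (FunctionSpaces.Torus.proj z.2) := rfl

variable [DecidableEq d]

/-- The **directional-derivative family** `∂_h ↔ 2πi ⟨k, h⟩`:
`dmulFamily h W i t k = 2πi ⟪latticeVec k, h⟫ · Wᵢ(t, k)` (`d/ds e_k(proj (y + s h)) =
2πi ⟨k, h⟩ e_k(proj y)`). [folklore] -/
def dmulFamily (h : EuclideanSpace ℝ d) (W : ℕ → ℝ → (d → ℤ) → ℂ) : ℕ → ℝ → (d → ℤ) → ℂ :=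
  fun i t k => (2 * π * Complex.I * (⟪FunctionSpaces.Torus.latticeVec k, h⟫ : ℂ)) * W i t k

/-- Unfolding `dmulFamily`. [folklore] -/
theorem dmulFamily_apply (h : EuclideanSpace ℝ d) (W : ℕ → ℝ → (d → ℤ) → ℂ) (i : ℕ) (t : ℝ)
    (k : d → ℤ) :
    dmulFamily h W i t k =
      (2 * π * Complex.I * (⟪FunctionSpaces.Torus.latticeVec k, h⟫ : ℂ)) * W i t k := rfl

/-- The `y`-derivative of the lifted character `y ↦ e_k(proj y) = 𝐞(⟪latticeVec k, y⟫)` as a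
continuous linear map: `h ↦ ⟪latticeVec k, h⟫ • (2πi e_k(proj y))` (chain rule with Mathlib's
`Real.hasDerivAt_fourierChar`; series twin of `FourierNS.charDeriv`). [folklore] -/
def echarCLM (k : d → ℤ) (y : EuclideanSpace ℝ d) : EuclideanSpace ℝ d →L[ℝ] ℂ :=
  (ContinuousLinearMap.smulRight (1 : ℝ →L[ℝ] ℝ)
    (2 * π * Complex.I * mFourier k (FunctionSpaces.Torus.proj y))).comp
      (innerSL ℝ (FunctionSpaces.Torus.latticeVec k))

/-- The candidate joint derivative at `(t, y)` of one term `W(t, k) e_k(proj y)` of the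
synthesized series, for a coefficient with time derivative `W'`:
`(τ, h) ↦ τ • (e_k(proj y) W') + W • (echarCLM k y) h` (series twin of
`FourierNS.synthDerivCLM`). [folklore] -/
def synthCLM (W W' : ℂ) (k : d → ℤ) (y : EuclideanSpace ℝ d) : ℝ × EuclideanSpace ℝ d →L[ℝ] ℂ :=
  (ContinuousLinearMap.fst ℝ ℝ (EuclideanSpace ℝ d)).smulRight
      (mFourier k (FunctionSpaces.Torus.proj y) * W') +
    W • ((echarCLM k y).comp (ContinuousLinearMap.snd ℝ ℝ (EuclideanSpace ℝ d)))

end Synthesis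

/-! ### The heat factor and the Picard iteration -/

section Picard

/-- The **heat rate** `νₖ = 4π²κ|k|²` of the frequency `k` (`κΔ ↔ -4π²κ|k|²`,
Grafakos 2014, Prop. 3.2.6 (8) twice; `|k|² = Torus.freqNormSq k`). [folklore] -/
def heatRate (κ : ℝ) (k : d → ℤ) : ℝ := 4 * π ^ 2 * κ * FunctionSpaces.Torus.freqNormSq k

/-- Unfolding `heatRate`. [folklore] -/
theorem heatRate_apply (κ : ℝ) (k : d → ℤ) :
    heatRate κ k = 4 * π ^ 2 * κ * FunctionSpaces.Torus.freqNormSq k := rfl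

/-- The **heat factor** `e^{-νₖ t}` (the Fourier multiplier of `e^{κtΔ}` on `T^d`). [folklore] -/
def heatFactor (κ : ℝ) (k : d → ℤ) (t : ℝ) : ℝ := Real.exp (-(heatRate κ k * t))

/-- Unfolding `heatFactor`. [folklore] -/
theorem heatFactor_apply (κ : ℝ) (k : d → ℤ) (t : ℝ) :
    heatFactor κ k t = Real.exp (-(heatRate κ k * t)) := rfl

/-- `e^{-νₖ · 0} = 1`. [folklore] -/
@[simp]
theorem heatFactor_zero (κ : ℝ) (k : d → ℤ) : heatFactor κ k 0 = 1 := by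
  simp [heatFactor]

/-- The **clamped Duhamel (Picard) map** of the mild system: with `τ = clamp T t`,
`Φ(c)(t, k) = e^{-νₖτ} a(k) + ∫₀^τ e^{-νₖ(τ-s)} (S(s,k) - N(U(s), c(s))(k)) ds`
(`a = θ̂₀`, `S = ŝ`, `Uⱼ = ûⱼ`; on `[0, T]` this is the genuine Duhamel formula for
`∂ₜc = -νₖ c + S - N(U, c)`, outside `[0,T]` the map only sees clamped time, as
`FourierNS.duhamel`). [folklore] -/
def picardMap (κ T : ℝ) (U : d → ℝ → (d → ℤ) → ℂ) (S : ℝ → (d → ℤ) → ℂ) (a : (d → ℤ) → ℂ)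
    (c : ℝ → (d → ℤ) → ℂ) (t : ℝ) (k : d → ℤ) : ℂ :=
  (heatFactor κ k (FourierNS.clamp T t) : ℂ) * a k +
    ∫ s in (0 : ℝ)..FourierNS.clamp T t, (heatFactor κ k (FourierNS.clamp T t - s) : ℂ) *
      (S s k - transportSym (fun j => U j s) (c s) k)

/-- The **Picard iterates** `c₀ = 0`, `cₙ₊₁ = Φ(cₙ)`. [folklore] -/
def picardIter (κ T : ℝ) (U : d → ℝ → (d → ℤ) → ℂ) (S : ℝ → (d → ℤ) → ℂ) (a : (d → ℤ) → ℂ) :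
    ℕ → ℝ → (d → ℤ) → ℂ
  | 0 => fun _ _ => 0
  | n + 1 => picardMap κ T U S a (picardIter κ T U S a n)

/-- `c₀ = 0`. [folklore] -/
@[simp]
theorem picardIter_zero (κ T : ℝ) (U : d → ℝ → (d → ℤ) → ℂ) (S : ℝ → (d → ℤ) → ℂ)
    (a : (d → ℤ) → ℂ) : picardIter κ T U S a 0 = fun _ _ => 0 := rfl

/-- `cₙ₊₁ = Φ(cₙ)`. [folklore] -/
theorem picardIter_succ (κ T : ℝ) (U : d → ℝ → (d → ℤ) → ℂ) (S : ℝ → (d → ℤ) → ℂ)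
    (a : (d → ℤ) → ℂ) (n : ℕ) :
    picardIter κ T U S a (n + 1) = picardMap κ T U S a (picardIter κ T U S a n) := rfl

/-- The **Picard limit** `c(t, k) = limₙ cₙ(t, k)` (pointwise `limUnder`; it is the genuine limit
under `PicardHyp`, file `ScalarFourierPicard`). [folklore] -/
def picardLim (κ T : ℝ) (U : d → ℝ → (d → ℤ) → ℂ) (S : ℝ → (d → ℤ) → ℂ) (a : (d → ℤ) → ℂ)
    (t : ℝ) (k : d → ℤ) : ℂ :=
  limUnder atTop fun n => picardIter κ T U S a n t k

/-- **Hypotheses of the Picard iteration** on the Fourier-side data: `κ > 0`, `T > 0`; the drift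
coefficients `Uⱼ(t)`, the source coefficients `S(t)` are continuous in `t ∈ ℝ` at every
frequency and have every polynomial decay uniformly in `t ∈ ℝ` (in the application they are the
coefficients of the smooth data at clamped time); the datum `a` has every polynomial decay. [folklore] -/
structure PicardHyp (κ T : ℝ) (U : d → ℝ → (d → ℤ) → ℂ) (S : ℝ → (d → ℤ) → ℂ)
    (a : (d → ℤ) → ℂ) : Prop where
  /-- positive diffusivity -/
  hκ : 0 < κ
  /-- positive final time -/
  hT : 0 < T
  /-- the drift coefficients are continuous in time at each frequency -/
  contU : ∀ j m, Continuous fun t => U j t m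
  /-- every polynomial decay of the drift coefficients, uniformly in time and component -/
  decayU : ∀ K : ℕ, ∃ A : ℝ, ∀ j t, FourierNS.HasDecay K A (U j t)
  /-- the source coefficients are continuous in time at each frequency -/
  contS : ∀ m, Continuous fun t => S t m
  /-- every polynomial decay of the source coefficients, uniformly in time -/
  decayS : ∀ K : ℕ, ∃ B : ℝ, ∀ t, FourierNS.HasDecay K B (S t)
  /-- every polynomial decay of the datum -/
  decayA : ∀ K : ℕ, ∃ A₀ : ℝ, FourierNS.HasDecay K A₀ a

/-- The **right-hand side of the differentiated mild system** applied to a family `W`, with the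
data families `UF` (drift, per component) and `SF` (source):
`(bootRHS κ UF SF W) i (t, k) = -νₖ Wᵢ(t,k) + SFᵢ(t,k) - Nᵢ(t)(k)` — the candidate for
`∂ₜ Wᵢ` when `W₀ = c` solves `∂ₜc = -νₖ c + S - N(U, c)` (bootstrap of
`ScalarFourierTimeRegularity`, as in `FourierNS.PicardHyp.exists_family`). [folklore] -/
def bootRHS (κ : ℝ) (UF : d → ℕ → ℝ → (d → ℤ) → ℂ) (SF : ℕ → ℝ → (d → ℤ) → ℂ)
    (W : ℕ → ℝ → (d → ℤ) → ℂ) : ℕ → ℝ → (d → ℤ) → ℂ :=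
  fun i t k => -(heatRate κ k : ℂ) * W i t k + SF i t k - transportFamily UF W i t k

/-- Unfolding `bootRHS`. [folklore] -/
theorem bootRHS_apply (κ : ℝ) (UF : d → ℕ → ℝ → (d → ℤ) → ℂ) (SF : ℕ → ℝ → (d → ℤ) → ℂ)
    (W : ℕ → ℝ → (d → ℤ) → ℂ) (i : ℕ) (t : ℝ) (k : d → ℤ) :
    bootRHS κ UF SF W i t k = -(heatRate κ k : ℂ) * W i t k + SF i t k - transportFamily UF W i t k :=
  rfl

end Picard

end ScalarFourier

end Literature.Analysis.FluidPDE

end
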